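import Literature.MathematicalPhysics.QuantumLattice.SpinChainsKnabeBlockProofs
import Literature.LinearAlgebra.Matrix.HermitianRankOneExpansion
import HarnessLib

/-!
# The Gosset–Mozgunov local gap threshold `6/(n(n+1))` for frustration-free chains

Trunk **T-QLATTICE**; theorem-only sequel of `SpinChainsKnabeProofs.lean` / `SpinChainsKnabeBlockProofs.lean`
(Knabe's finite-size criterion, threshold `1/(n-1)`), in the same vocabulary: a family `P : ℤ/N → M_n(ℂ)` of
orthogonal projections on a ring, `P_i` commuting with `P_{i+d}` unless `d ∈ {0, ±1}` (nearest-neighbour bond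
projections), blocks of `b = n - 1` consecutive projections `A_i = Σ_{j<b} P_{i+j}` (the open sub-chain of `n` sites),
`H = Σ_i P_i`.  No definition, no named fact.

## The source, as printed

D. Gosset, E. Mozgunov, *Local gap threshold for frustration-free spin systems*, J. Math. Phys. **57** (2016) 091901
(arXiv:1512.00088), §2, for the translation-invariant periodic chain `H°_m = Σ_{i=1}^m h_{i,i+1}` of nearest-neighbour
projectors and the open sub-chains `H_n`, with smallest non-zero eigenvalues `ε°_m`, `ε_n`:

* "**Theorem 3.** Let `n > 2` and `m > 2n`. Then `ε°_m ≥ (5/6) ((n² + n)/(n² - 4)) (ε_n - 6/(n(n+1)))`."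
* §2.1 (strategy): deformed sub-chain operators `B_{n,k} = Σ_{i=k}^{n-2+k} c_{i-k} h_{i,i+1}` (Kitaev); "**Lemma 4.**
  … there exists a normalized state `|φ⟩` in this eigenspace which satisfies
  `⟨φ|B²_{n,k}|φ⟩ ≥ ε_n ((1/(n-1)) Σ_j c_j) ⟨φ|B_{n,k}|φ⟩` for each `k`" (proof by translation invariance);
* §2.2: `(H°_m)² + β H°_m - α Σ_k B²_{n,k} ≥ Σ_{2 ≤ d(i,j) ≤ n-2} h_i h_j (1 - α Σ_r c_r c_{r+d(i,j)})` (eq. (positive)),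
  positive as soon as `q(x) = Σ_j c_j c_{j+x}` is non-increasing (Lemma, Appendix), with `α = 1/q(1)`,
  `β = α (Σ c_j² - q(1))`; hence `(H°_m)² + β H°_m ≥ α Σ_k B²_{n,k}` (eq. (posdef)), and with Lemma 4
  `ε°_m ≥ F(n)(ε_n - G(n))`, `F = (Σ c_j)² / ((n-1) q(1))`, `G = (n-1)(Σ c_j² - q(1))/(Σ c_j)²` (eqs. (finalbnd),
  (F), (G)); the choice `c_j = (n-1) + (n-2) j - j²` (`= (j+1)(n-1-j)`) gives `Σ c_j = (n³-n)/6`,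
  `Σ c_j² = (n⁵-n)/30`, `Σ c_j c_{j+1} = n⁵/30 - n³/6 + 2n/15`, `F = (5/6)(n²+n)/(n²-4)`, `G = 6/(n(n+1))`.

## What is proved here (b = n - 1 bond projections per block, ring of N = m bonds)

* `sum_range_sum_range_smul_sub_natCast` — the weighted window resummation
  `Σ_{j,l<b} c_j c_l F(l-j) + (Σ c_j²) F(0) = Σ_{t<b} q(t) (F(t) + F(-t))`, `q(t) = Σ_{r<b-t} c_r c_{r+t}`;
* ★ `gossetMozgunov_weighted_sq_posSemidef` — eq. (posdef) as an exact identity: for arbitrary real weights,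
  `q(1) H² + (Σc² - q(1)) H - Σ_i B_i² = Σ_{t=2}^{N-2} (q(1) - q(t) - q(N-t)) S(t)`, `S(t) = Σ_i P_i P_{i+t} ≥ 0`,
  positive under the coefficient condition `q(t) + q(N-t) ≤ q(1)` (`2 ≤ t ≤ N-2`);
* ★ `eps_mul_normSq_dotProduct_le` — the per-block step behind Lemma 4, WITHOUT translation invariance: if
  `A ≥ 0`, `A² ≥ εA`, `B` Hermitian with `ker A ⊆ ker B`, then `ε |⟨φ, Bφ⟩|² ≤ ⟨φ, Aφ⟩ ‖Bφ‖²` for every `φ`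
  (spectral decomposition of `A`: `⟨φ,Bφ⟩ = ⟨Qφ, Bφ⟩`, `εQ ≤ A`, `Q` the projection onto `(ker A)^⊥`);
* ★ `gossetMozgunov_sum_weighted_sq_sub_smul_posSemidef` — summing the per-block step with the Cauchy–Schwarz
  inequality across blocks (`Σ_k x_k²/a_k ≥ (Σ x_k)²/Σ a_k`) gives the OPERATOR inequality
  `Σ_i B_i² ≥ ε ((Σ c_j)²/b) H` — the summed content of Lemma 4 + eq. (epsbnd), for every vector, hence with no
  translation invariance and no choice of eigenvector;
* ★ `gossetMozgunov_weighted_ring_sq_sub_smul_posSemidef` — eq. (finalbnd) in Knabe's operator form: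
  `H² ≥ F(c) (ε - G(c)) H` for any real weights with `q(1) > 0` satisfying the coefficient condition;
* `gossetMozgunov_weights_partial_sum`, `gossetMozgunov_weights_sum` — the closed forms behind (csum)–(ccp1) for
  `c_j = (j+1)(b-j)`, as polynomial identities for the partial sums;
* ★★ `gossetMozgunov_ring_sq_sub_smul_posSemidef` — **Theorem 3**:
  `H² - (5(b+1)(b+2)/(6(b-1)(b+3))) (ε - 6/((b+1)(b+2))) H ≥ 0`, i.e. with `n = b + 1`,
  `H² ≥ (5/6)((n²+n)/(n²-4)) (ε_n - 6/(n(n+1))) H`, for `b ≥ 2` and `N ≥ max(b + 2, 2b - 1)` (the printed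
  `m > 2n` implies both); the Appendix Lemma is replaced, for these specific weights, by the explicit polynomial
  certificate `30 (q(1) - q(t)) = D(t-2, b-1-t)` with `D ∈ ℕ[s,k]` (all coefficients positive);
* `gossetMozgunov_ring_sq_sub_smul_posSemidef_sites` (parametrised by `n`) and
  `gossetMozgunov_ring_eigenvalue_eq_zero_or_le` — the printed form: every non-zero eigenvalue of `H` is
  `≥ (5/6)((n²+n)/(n²-4))(ε - 6/(n(n+1)))`.

REMARK (scope, stated honestly).  The printed theorem assumes translation invariance (used only in Lemma 4) and
`m > 2n`; the proof formalised here follows §2.1–2.2 verbatim for the squaring step and replaces Lemma 4 by its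
summed form, which holds for every vector by the Cauchy–Schwarz inequality across blocks — so the formal statement
has no translation-invariance hypothesis and is an operator inequality `H² ≥ γ H` exactly as Knabe's; the printed
Theorem 3 is the special case read on an eigenvector (`gossetMozgunov_ring_eigenvalue_eq_zero_or_le`).  Nothing here
concerns the two-dimensional Theorem 5, nor transfer matrices of lattice gauge theories (not frustration-free).

## References
* D. Gosset, E. Mozgunov, J. Math. Phys. **57** (2016) 091901, arXiv:1512.00088, §2 (Thm. 3, Lemma 4, §2.1–2.2,
  Appendix). [GossetMozgunov2016]
* S. Knabe, J. Stat. Phys. **52** (1988) 627–638, §2. [Knabe1988]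
-/

noncomputable section

open Matrix Complex Finset
open scoped ComplexOrder ComplexConjugate

namespace Literature.MathematicalPhysics.QuantumLattice

section GossetMozgunov



/-- weighted window resummation [cite: GossetMozgunov2016, §2.2] -/
theorem sum_range_sum_range_smul_sub_natCast {R M : Type*} [CommSemiring R] [AddCommMonoid M]
    [Module R M] {N : ℕ} (c : ℕ → R) (F : ZMod N → M) (b : ℕ) :
    (∑ j ∈ range b, ∑ l ∈ range b, (c j * c l) • F ((l : ZMod N) - (j : ZMod N))) +
        (∑ j ∈ range b, c j * c j) • F 0 =
      ∑ t ∈ range b, (∑ r ∈ range (b - t), c r * c (r + t)) • (F (t : ZMod N) + F (-(t : ZMod N))) := by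
  induction b with
  | zero => simp
  | succ b ih =>
    -- the window coefficients at `b + 1` versus `b`
    have hq : ∀ t ∈ range (b + 1), (∑ r ∈ range (b + 1 - t), c r * c (r + t)) =
        (∑ r ∈ range (b - t), c r * c (r + t)) + c (b - t) * c b := by
      intro t ht
      rw [mem_range] at ht
      rw [show b + 1 - t = (b - t) + 1 by omega, sum_range_succ, show b - t + t = b by omega]
    -- reflections of the boundary sums
    have hrefl : ∑ j ∈ range (b + 1), (c j * c b) • (F ((b : ZMod N) - (j : ZMod N)) +
        F ((j : ZMod N) - (b : ZMod N))) =
        ∑ t ∈ range (b + 1), (c (b - t) * c b) • (F (t : ZMod N) + F (-(t : ZMod N))) := by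
      rw [← sum_range_reflect (fun t => (c (b - t) * c b) •
        (F (t : ZMod N) + F (-(t : ZMod N)))) (b + 1)]
      refine sum_congr rfl fun j hj => ?_
      rw [mem_range] at hj
      simp only [Nat.add_sub_cancel]
      rw [show b - (b - j) = j by omega, Nat.cast_sub (by omega : j ≤ b), neg_sub]
    -- left side at `b + 1`
    have hL : (∑ j ∈ range (b + 1), ∑ l ∈ range (b + 1),
          (c j * c l) • F ((l : ZMod N) - (j : ZMod N))) +
        (∑ j ∈ range (b + 1), c j * c j) • F 0 =
        ((∑ j ∈ range b, ∑ l ∈ range b, (c j * c l) • F ((l : ZMod N) - (j : ZMod N))) +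
          (∑ j ∈ range b, c j * c j) • F 0) +
        (∑ j ∈ range (b + 1), (c j * c b) • (F ((b : ZMod N) - (j : ZMod N)) +
          F ((j : ZMod N) - (b : ZMod N)))) := by
      rw [sum_range_succ (fun j => ∑ l ∈ range (b + 1), (c j * c l) • F ((l : ZMod N) - (j : ZMod N))),
        sum_congr rfl fun j _ => sum_range_succ (fun l => (c j * c l) • F ((l : ZMod N) - (j : ZMod N))) b,
        sum_add_distrib, sum_range_succ (fun l => (c b * c l) • F ((l : ZMod N) - (b : ZMod N))),
        sum_range_succ (fun j => c j * c j), add_smul,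
        sum_range_succ (fun j => (c j * c b) • (F ((b : ZMod N) - (j : ZMod N)) +
          F ((j : ZMod N) - (b : ZMod N))))]
      simp only [smul_add, sum_add_distrib, sub_self]
      have e : ∀ l ∈ range b, (c b * c l) • F ((l : ZMod N) - (b : ZMod N)) =
          (c l * c b) • F ((l : ZMod N) - (b : ZMod N)) := fun l _ => by rw [mul_comm]
      rw [sum_congr rfl e]
      abel
    -- right side at `b + 1`
    have hR : ∑ t ∈ range (b + 1), (∑ r ∈ range (b + 1 - t), c r * c (r + t)) •
          (F (t : ZMod N) + F (-(t : ZMod N))) =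
        ∑ t ∈ range b, (∑ r ∈ range (b - t), c r * c (r + t)) •
          (F (t : ZMod N) + F (-(t : ZMod N))) +
        ∑ t ∈ range (b + 1), (c (b - t) * c b) • (F (t : ZMod N) + F (-(t : ZMod N))) := by
      rw [sum_congr rfl fun t ht => by rw [hq t ht, add_smul], sum_add_distrib,
        sum_range_succ (fun t => (∑ r ∈ range (b - t), c r * c (r + t)) •
          (F (t : ZMod N) + F (-(t : ZMod N)))), Nat.sub_self, range_zero, sum_empty, zero_smul,
        add_zero]
    rw [hL, hR, ih, hrefl]


variable {n : Type*} [Fintype n] [DecidableEq n]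

omit [DecidableEq n] in
/-- **The Knabe–Gosset–Mozgunov squaring inequality with deformed sub-chain operators.** [cite: GossetMozgunov2016, §2.2] -/
theorem gossetMozgunov_weighted_sq_posSemidef {N : ℕ} [NeZero N] {b : ℕ} (hb : 2 ≤ b)
    (hN : b + 2 ≤ N) (P : ZMod N → Matrix n n ℂ) (hherm : ∀ i, (P i).IsHermitian)
    (hidem : ∀ i, P i * P i = P i)
    (hcomm : ∀ i d : ZMod N, d ≠ 0 → d ≠ 1 → d ≠ -1 → P i * P (i + d) = P (i + d) * P i)
    (c : ℕ → ℝ)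
    (hcond : ∀ t : ℕ, 2 ≤ t → t + 2 ≤ N →
      (∑ r ∈ range (b - t), c r * c (r + t)) + (∑ r ∈ range (b - (N - t)), c r * c (r + (N - t))) ≤
        ∑ r ∈ range (b - 1), c r * c (r + 1)) :
    ((((∑ r ∈ range (b - 1), c r * c (r + 1) : ℝ)) : ℂ) • ((∑ i, P i) * (∑ i, P i)) +
      ((((∑ j ∈ range b, c j * c j) - ∑ r ∈ range (b - 1), c r * c (r + 1) : ℝ)) : ℂ) • (∑ i, P i) -
      ∑ i, (∑ j ∈ range b, (c j : ℂ) • P (i + (j : ZMod N))) *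
        (∑ j ∈ range b, (c j : ℂ) • P (i + (j : ZMod N)))).PosSemidef := by
  -- notation
  set H : Matrix n n ℂ := ∑ i, P i with hH
  set S : ZMod N → Matrix n n ℂ := fun d => ∑ i : ZMod N, P i * P (i + d) with hS
  set B : ZMod N → Matrix n n ℂ := fun i => ∑ j ∈ range b, (c j : ℂ) • P (i + (j : ZMod N)) with hB
  set q : ℕ → ℝ := fun t => ∑ r ∈ range (b - t), c r * c (r + t) with hq
  have hN1 : 1 ≤ N := by omega
  -- residues
  have hm1 : (-1 : ZMod N) = ((N - 1 : ℕ) : ZMod N) := by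
    rw [Nat.cast_sub hN1, ZMod.natCast_self, zero_sub, Nat.cast_one]
  have hne0 : ∀ t : ℕ, 2 ≤ t → t < N - 1 → (t : ZMod N) ≠ 0 := fun t ht1 ht2 => by
    exact_mod_cast natCast_ne_natCast_zmod (N := N) (a := t) (b := 0) (by omega) (by omega)
      (by omega)
  have hne1 : ∀ t : ℕ, 2 ≤ t → t < N - 1 → (t : ZMod N) ≠ 1 := fun t ht1 ht2 => by
    exact_mod_cast natCast_ne_natCast_zmod (N := N) (a := t) (b := 1) (by omega) (by omega)
      (by omega)
  have hnem1 : ∀ t : ℕ, 2 ≤ t → t < N - 1 → (t : ZMod N) ≠ -1 := fun t ht1 ht2 => by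
    rw [hm1]
    exact natCast_ne_natCast_zmod (N := N) (by omega) (by omega) (by omega)
  -- positivity of the pair sums at distance `d ∉ {0, ±1}`
  have hSpos : ∀ d : ZMod N, d ≠ 0 → d ≠ 1 → d ≠ -1 → (S d).PosSemidef := by
    intro d hd0 hd1 hdm1
    exact posSemidef_sum _ fun i _ =>
      posSemidef_mul_of_commute (hherm i) (hidem i) (hherm _) (hidem _) (hcomm i d hd0 hd1 hdm1)
  -- (a) `H² = Σ_d S(d)`, `S(0) = H`, and the residues enumerated
  have hsq : H * H = ∑ d, S d := sum_mul_sum_eq_sum_sum_shift P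
  have hS0 : S 0 = H := by
    simp only [hS, hH, add_zero, hidem]
  have hsumS : ∑ d, S d = ∑ t ∈ range N, S (t : ZMod N) := by
    refine sum_nbij' (fun d => d.val) (fun t => (t : ZMod N)) (fun d _ => ?_) (fun _ _ => mem_univ _)
      (fun d _ => ZMod.natCast_zmod_val d) (fun t ht => ?_) (fun d _ => by rw [ZMod.natCast_zmod_val])
    · exact mem_range.2 (ZMod.val_lt d)
    · rw [mem_range] at ht
      rw [ZMod.val_natCast, Nat.mod_eq_of_lt ht]
  have hsplit : ∑ d, S d = S 0 + S 1 + ∑ t ∈ Ico 2 (N - 1), S (t : ZMod N) + S (-1) := by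
    rw [hsumS, range_eq_Ico, sum_eq_sum_Ico_succ_bot (by omega), sum_eq_sum_Ico_succ_bot (by omega),
      show Ico (0 + 1 + 1) N = Ico 2 (N - 1 + 1) by congr 1; omega, sum_Ico_succ_top (by omega),
      hm1]
    push_cast
    abel
  -- (b) the deformed block sums: `Σ_i B_i² = Σ_{j,l<b} c_j c_l S(l - j)`
  have hsumB2 : ∑ i, B i * B i =
      ∑ j ∈ range b, ∑ l ∈ range b,
        ((c j : ℂ) * (c l : ℂ)) • S ((l : ZMod N) - (j : ZMod N)) := by
    simp only [hB, sum_mul_sum, smul_mul_smul_comm]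
    rw [sum_comm]
    refine sum_congr rfl fun j _ => ?_
    rw [sum_comm]
    refine sum_congr rfl fun l _ => ?_
    rw [← smul_sum]
    congr 1
    have e : ∀ i : ZMod N, P (i + (j : ZMod N)) * P (i + (l : ZMod N)) =
        P (i + (j : ZMod N)) * P (i + (j : ZMod N) + ((l : ZMod N) - (j : ZMod N))) := by
      intro i; congr 2; abel
    simp only [e]
    exact Equiv.sum_comp (Equiv.addRight (j : ZMod N))
      (fun i => P i * P (i + ((l : ZMod N) - (j : ZMod N))))
  -- (c) the window resummation, coefficients `q(t) = Σ_{r<b-t} c_r c_{r+t}`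
  have hF := sum_range_sum_range_smul_sub_natCast (fun j => (c j : ℂ)) S b
  have hqcast : ∀ t, (∑ r ∈ range (b - t), (c r : ℂ) * (c (r + t) : ℂ)) = ((q t : ℝ) : ℂ) := by
    intro t; simp only [hq]; push_cast; rfl
  have hq0 : ((q 0 : ℝ) : ℂ) = (((∑ j ∈ range b, c j * c j : ℝ)) : ℂ) := by
    simp only [hq, Nat.sub_zero, add_zero]
  have hF' : (∑ j ∈ range b, ∑ l ∈ range b,
        ((c j : ℂ) * (c l : ℂ)) • S ((l : ZMod N) - (j : ZMod N))) +
        (((∑ j ∈ range b, c j * c j : ℝ)) : ℂ) • S 0 =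
      (((∑ j ∈ range b, c j * c j : ℝ)) : ℂ) • (S 0 + S 0) + ((q 1 : ℝ) : ℂ) • (S 1 + S (-1)) +
        ∑ t ∈ Ico 2 b, ((q t : ℝ) : ℂ) • (S (t : ZMod N) + S (-(t : ZMod N))) := by
    have h1 : (∑ j ∈ range b, (c j : ℂ) * (c j : ℂ)) = (((∑ j ∈ range b, c j * c j : ℝ)) : ℂ) := by
      push_cast; rfl
    rw [h1] at hF
    simp only [hqcast] at hF
    have hpeel : ∀ f : ℕ → Matrix n n ℂ, ∑ t ∈ range b, f t = f 0 + f 1 + ∑ t ∈ Ico 2 b, f t := by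
      intro f
      rw [range_eq_Ico, sum_eq_sum_Ico_succ_bot (by omega), sum_eq_sum_Ico_succ_bot (by omega),
        show Ico (0 + 1 + 1) b = Ico 2 b by rfl, add_assoc]
    rw [hF, hpeel, hq0]
    simp only [Nat.cast_zero, Nat.cast_one, neg_zero]
  -- (d) extend the window sums to `2 ≤ t ≤ N - 2` and reflect the negative offsets
  have hsub : Ico 2 b ⊆ Ico 2 (N - 1) := Ico_subset_Ico_right (by omega)
  have hqvan : ∀ t, b ≤ t → q t = 0 := by
    intro t ht
    simp only [hq, Nat.sub_eq_zero_of_le ht, range_zero, sum_empty]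
  have hext1 : ∑ t ∈ Ico 2 b, ((q t : ℝ) : ℂ) • S (t : ZMod N) =
      ∑ t ∈ Ico 2 (N - 1), ((q t : ℝ) : ℂ) • S (t : ZMod N) := by
    refine sum_subset hsub fun t ht ht' => ?_
    rw [mem_Ico] at ht ht'
    rw [hqvan t (by omega), Complex.ofReal_zero, zero_smul]
  have hext2 : ∑ t ∈ Ico 2 b, ((q t : ℝ) : ℂ) • S (-(t : ZMod N)) =
      ∑ t ∈ Ico 2 (N - 1), ((q (N - t) : ℝ) : ℂ) • S (t : ZMod N) := by
    have h1 : ∑ t ∈ Ico 2 b, ((q t : ℝ) : ℂ) • S (-(t : ZMod N)) =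
        ∑ t ∈ Ico 2 (N - 1), ((q t : ℝ) : ℂ) • S (-(t : ZMod N)) := by
      refine sum_subset hsub fun t ht ht' => ?_
      rw [mem_Ico] at ht ht'
      rw [hqvan t (by omega), Complex.ofReal_zero, zero_smul]
    have h2 := sum_Ico_reflect (fun s => ((q (N - s) : ℝ) : ℂ) • S (s : ZMod N)) 2 (m := N - 1)
      (n := N) (by omega)
    rw [show N + 1 - (N - 1) = 2 by omega, show N + 1 - 2 = N - 1 by omega] at h2
    rw [h1, ← h2]
    refine sum_congr rfl fun t ht => ?_
    rw [mem_Ico] at ht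
    rw [show N - (N - t) = t by omega, Nat.cast_sub (by omega : t ≤ N), ZMod.natCast_self, zero_sub]
  -- (e) the positive remainder
  set E : Matrix n n ℂ :=
    ∑ t ∈ Ico 2 (N - 1), (((q 1 - q t - q (N - t) : ℝ)) : ℂ) • S (t : ZMod N) with hE
  have hEpos : E.PosSemidef := by
    refine posSemidef_sum _ fun t ht => ?_
    rw [mem_Ico] at ht
    refine PosSemidef.smul (hSpos _ (hne0 t ht.1 ht.2) (hne1 t ht.1 ht.2) (hnem1 t ht.1 ht.2)) ?_
    have h := hcond t ht.1 (by omega)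
    exact Complex.zero_le_real.2 (by simp only [hq]; linarith)
  have hEeq : E = ((q 1 : ℝ) : ℂ) • ∑ t ∈ Ico 2 (N - 1), S (t : ZMod N) -
      ∑ t ∈ Ico 2 (N - 1), ((q t : ℝ) : ℂ) • S (t : ZMod N) -
      ∑ t ∈ Ico 2 (N - 1), ((q (N - t) : ℝ) : ℂ) • S (t : ZMod N) := by
    rw [hE, smul_sum, ← sum_sub_distrib, ← sum_sub_distrib]
    refine sum_congr rfl fun t _ => ?_
    rw [Complex.ofReal_sub, Complex.ofReal_sub, sub_smul, sub_smul]
  -- (f) the exact identity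
  have hB2 : ∑ i, B i * B i = (((∑ j ∈ range b, c j * c j : ℝ)) : ℂ) • H +
      ((q 1 : ℝ) : ℂ) • (S 1 + S (-1)) +
      ∑ t ∈ Ico 2 (N - 1), ((q t : ℝ) : ℂ) • S (t : ZMod N) +
      ∑ t ∈ Ico 2 (N - 1), ((q (N - t) : ℝ) : ℂ) • S (t : ZMod N) := by
    have h := hF'
    rw [← hsumB2] at h
    simp only [smul_add, sum_add_distrib] at h
    rw [hext1, hext2, hS0] at h
    have h' : ∑ i, B i * B i =
        (∑ i, B i * B i + (((∑ j ∈ range b, c j * c j : ℝ)) : ℂ) • H) -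
          (((∑ j ∈ range b, c j * c j : ℝ)) : ℂ) • H := by
      rw [add_sub_cancel_right]
    rw [h', h]
    module
  have hid : (((∑ r ∈ range (b - 1), c r * c (r + 1) : ℝ)) : ℂ) • (H * H) +
      ((((∑ j ∈ range b, c j * c j) - ∑ r ∈ range (b - 1), c r * c (r + 1) : ℝ)) : ℂ) • H -
      ∑ i, B i * B i = E := by
    have hq1 : (((∑ r ∈ range (b - 1), c r * c (r + 1) : ℝ)) : ℂ) = ((q 1 : ℝ) : ℂ) := rfl
    rw [Complex.ofReal_sub, hq1, hB2, hEeq, hsq, hsplit, hS0]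
    module
  rw [hid]
  exact hEpos




open Literature.LinearAlgebra.Matrix in
/-- **Spectral Cauchy–Schwarz for a gapped positive operator.**  If `A ≥ 0`, `A² - εA ≥ 0` (`ε > 0`; i.e. the
spectrum of `A` lies in `{0} ∪ [ε, ∞)`), `B` is Hermitian and `ker A ⊆ ker B`, then for every vector `φ`:
`ε |⟨φ, Bφ⟩|² ≤ ⟨φ, Aφ⟩ · ‖Bφ‖²` — since `⟨φ, Bφ⟩ = ⟨Qφ, Bφ⟩` with `Q` the projection onto `(ker A)^⊥` and
`εQ ≤ A`.  (The per-block step behind Gosset–Mozgunov's Lemma 4 / eq. (B2bnd), in a form that needs no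
translation invariance.) [cite: GossetMozgunov2016, §2.1 Lemma 4] -/
theorem eps_mul_normSq_dotProduct_le {A B : Matrix n n ℂ} (hA : A.PosSemidef) {ε : ℝ} (hε : 0 < ε)
    (hsq : (A * A - (ε : ℂ) • A).PosSemidef) (hB : B.IsHermitian)
    (hker : ∀ v : n → ℂ, A *ᵥ v = 0 → B *ᵥ v = 0) (φ : n → ℂ) :
    ε * ‖star φ ⬝ᵥ (B *ᵥ φ)‖ ^ 2 ≤
      (star φ ⬝ᵥ (A *ᵥ φ)).re * (star (B *ᵥ φ) ⬝ᵥ (B *ᵥ φ)).re := by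
  -- eigenvector coordinates of `A`
  set e : n → n → ℂ := fun i => ⇑(hA.1.eigenvectorBasis i) with he
  set lam : n → ℝ := hA.1.eigenvalues with hlam
  set κ : (n → ℂ) → n → ℂ := fun w i => ∑ x, conj (e i x) * w x with hκ
  -- (0) Plancherel in coordinates
  have hplanch : ∀ u w : n → ℂ, star u ⬝ᵥ w = ∑ i, conj (κ u i) * κ w i := by
    intro u w
    have hexp := eigvec_expand hA.1 w
    calc star u ⬝ᵥ w = ∑ x, conj (u x) * w x := by
          simp only [dotProduct, Pi.star_apply, RCLike.star_def]
      _ = ∑ x, conj (u x) * ∑ i, κ w i * e i x := by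
          refine Finset.sum_congr rfl fun x _ => ?_
          congr 1
          conv_lhs => rw [hexp]
          simp only [Finset.sum_apply, Pi.smul_apply, smul_eq_mul]
          rfl
      _ = ∑ i, κ w i * ∑ x, conj (u x) * e i x := by
          simp only [Finset.mul_sum]
          rw [Finset.sum_comm]
          refine Finset.sum_congr rfl fun i _ => ?_
          exact Finset.sum_congr rfl fun x _ => by ring
      _ = ∑ i, conj (κ u i) * κ w i := by
          refine Finset.sum_congr rfl fun i _ => ?_
          have : conj (κ u i) = ∑ x, conj (u x) * e i x := by
            simp only [hκ, map_sum, map_mul, Complex.conj_conj]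
            refine Finset.sum_congr rfl fun x _ => ?_
            ring
          rw [this, mul_comm]
  -- norm-square form of Plancherel
  have hnormsq : ∀ w : n → ℂ, (star w ⬝ᵥ w).re = ∑ i, ‖κ w i‖ ^ 2 := by
    intro w
    rw [hplanch, Complex.re_sum]
    refine Finset.sum_congr rfl fun i _ => ?_
    rw [mul_comm, Complex.mul_conj, Complex.normSq_eq_norm_sq]
    norm_cast
  -- (1) the quadratic form of `A`
  have hquad : (star φ ⬝ᵥ (A *ᵥ φ)).re = ∑ i, lam i * ‖κ φ i‖ ^ 2 := by
    rw [hermitian_quadform_eq_sum hA.1 φ, Complex.re_sum]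
    refine Finset.sum_congr rfl fun i _ => ?_
    rw [← Complex.ofReal_mul, Complex.ofReal_re]
  -- (2) eigenvalues are `0` or `≥ ε`
  have hev : ∀ i, lam i = 0 ∨ ε ≤ lam i := by
    intro i
    have hv : A *ᵥ e i = ((lam i : ℝ) : ℂ) • e i := by
      have h := hA.1.mulVec_eigenvectorBasis i
      rw [RCLike.real_smul_eq_coe_smul (K := ℂ)] at h
      exact h
    have hv0 : e i ≠ 0 := by
      intro h0
      have h1 := eigvec_orthonormal hA.1 i i
      rw [if_pos rfl] at h1
      have : (∑ x, conj ((hA.1.eigenvectorBasis i) x) * (hA.1.eigenvectorBasis i) x) = 0 := by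
        refine Finset.sum_eq_zero fun x _ => ?_
        have hx : e i x = 0 := by rw [h0]; rfl
        simp only [he] at hx
        rw [hx, mul_zero]
      rw [this] at h1
      exact zero_ne_one h1
    exact eigenvalue_eq_zero_or_le_of_sq_sub_smul_posSemidef hA hsq hv hv0
  -- (3) the `B`-coordinates vanish on `ker A`
  have hkerB : ∀ i, lam i = 0 → κ (B *ᵥ φ) i = 0 := by
    intro i hi
    have hAe : A *ᵥ e i = 0 := by
      have h := hA.1.mulVec_eigenvectorBasis i
      rw [show hA.1.eigenvalues i = lam i from rfl, hi, zero_smul] at h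
      exact h
    have hBe : B *ᵥ e i = 0 := hker _ hAe
    have h1 : κ (B *ᵥ φ) i = star (e i) ⬝ᵥ (B *ᵥ φ) := by
      simp only [hκ, dotProduct, Pi.star_apply, RCLike.star_def]
    rw [h1, dotProduct_mulVec, ← hB.eq, ← star_mulVec, hBe, star_zero, zero_dotProduct]
  -- (4) the estimate
  set T : Finset n := Finset.univ.filter fun i => lam i ≠ 0 with hT
  have hx : star φ ⬝ᵥ (B *ᵥ φ) = ∑ i ∈ T, conj (κ φ i) * κ (B *ᵥ φ) i := by
    rw [hplanch, ← Finset.sum_filter_add_sum_filter_not Finset.univ (fun i => lam i ≠ 0)]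
    rw [Finset.sum_eq_zero (s := Finset.univ.filter fun i => ¬ lam i ≠ 0), add_zero]
    intro i hi
    rw [Finset.mem_filter, not_not] at hi
    rw [hkerB i hi.2, mul_zero]
  have hxbound : ‖star φ ⬝ᵥ (B *ᵥ φ)‖ ≤ ∑ i ∈ T, ‖κ φ i‖ * ‖κ (B *ᵥ φ) i‖ := by
    rw [hx]
    refine (norm_sum_le _ _).trans (le_of_eq ?_)
    refine Finset.sum_congr rfl fun i _ => ?_
    rw [norm_mul, RCLike.norm_conj]
  have hCS : (∑ i ∈ T, ‖κ φ i‖ * ‖κ (B *ᵥ φ) i‖) ^ 2 ≤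
      (∑ i ∈ T, ‖κ φ i‖ ^ 2) * ∑ i ∈ T, ‖κ (B *ᵥ φ) i‖ ^ 2 :=
    sum_mul_sq_le_sq_mul_sq T _ _
  have hQ : ε * ∑ i ∈ T, ‖κ φ i‖ ^ 2 ≤ (star φ ⬝ᵥ (A *ᵥ φ)).re := by
    rw [hquad, Finset.mul_sum,
      ← Finset.sum_filter_add_sum_filter_not Finset.univ (fun i => lam i ≠ 0)]
    have h2 : ∑ i ∈ Finset.univ.filter (fun i => ¬ lam i ≠ 0), lam i * ‖κ φ i‖ ^ 2 = 0 := by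
      refine Finset.sum_eq_zero fun i hi => ?_
      rw [Finset.mem_filter, not_not] at hi
      rw [hi.2, zero_mul]
    rw [h2, add_zero]
    refine Finset.sum_le_sum fun i hi => ?_
    rw [hT, Finset.mem_filter] at hi
    have hle : ε ≤ lam i := (hev i).resolve_left hi.2
    exact mul_le_mul_of_nonneg_right hle (sq_nonneg _)
  have hY : ∑ i ∈ T, ‖κ (B *ᵥ φ) i‖ ^ 2 ≤ (star (B *ᵥ φ) ⬝ᵥ (B *ᵥ φ)).re := by
    rw [hnormsq]
    exact Finset.sum_le_sum_of_subset_of_nonneg (Finset.filter_subset _ _)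
      fun i _ _ => sq_nonneg _
  have hT0 : 0 ≤ ∑ i ∈ T, ‖κ φ i‖ ^ 2 := Finset.sum_nonneg fun i _ => sq_nonneg _
  have hY0 : 0 ≤ ∑ i ∈ T, ‖κ (B *ᵥ φ) i‖ ^ 2 := Finset.sum_nonneg fun i _ => sq_nonneg _
  calc ε * ‖star φ ⬝ᵥ (B *ᵥ φ)‖ ^ 2
      ≤ ε * (∑ i ∈ T, ‖κ φ i‖ * ‖κ (B *ᵥ φ) i‖) ^ 2 := by
        refine mul_le_mul_of_nonneg_left ?_ hε.le
        exact pow_le_pow_left₀ (norm_nonneg _) hxbound 2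
    _ ≤ ε * ((∑ i ∈ T, ‖κ φ i‖ ^ 2) * ∑ i ∈ T, ‖κ (B *ᵥ φ) i‖ ^ 2) :=
        mul_le_mul_of_nonneg_left hCS hε.le
    _ = (ε * ∑ i ∈ T, ‖κ φ i‖ ^ 2) * ∑ i ∈ T, ‖κ (B *ᵥ φ) i‖ ^ 2 := by ring
    _ ≤ (star φ ⬝ᵥ (A *ᵥ φ)).re * (star (B *ᵥ φ) ⬝ᵥ (B *ᵥ φ)).re :=
        mul_le_mul hQ hY hY0 ((mul_nonneg hε.le hT0).trans hQ)


omit [DecidableEq n] in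
/-- Quadratic forms of positive matrices are real. [folklore] -/
private theorem dotProduct_mulVec_eq_re {M : Matrix n n ℂ} (hM : M.PosSemidef) (φ : n → ℂ) :
    star φ ⬝ᵥ (M *ᵥ φ) = (((star φ ⬝ᵥ (M *ᵥ φ)).re : ℝ) : ℂ) := by
  have h := Complex.nonneg_iff.1 (hM.dotProduct_mulVec_nonneg φ)
  exact Complex.ext (by simp) (by rw [Complex.ofReal_im]; exact h.2.symm)

omit [DecidableEq n] in
/-- `⟨φ, B²φ⟩ = ⟨Bφ, Bφ⟩` for Hermitian `B`. [folklore] -/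
private theorem dotProduct_mulVec_mul_self {B : Matrix n n ℂ} (hB : B.IsHermitian) (φ : n → ℂ) :
    star φ ⬝ᵥ ((B * B) *ᵥ φ) = star (B *ᵥ φ) ⬝ᵥ (B *ᵥ φ) := by
  rw [← mulVec_mulVec, dotProduct_mulVec, star_mulVec, hB.eq]

/-- **Gosset–Mozgunov's Lemma 4 in summed operator form (no translation invariance needed).**
[cite: GossetMozgunov2016, §2.1 Lemma 4, §2.2 eq. (epsbnd)] -/
theorem gossetMozgunov_sum_weighted_sq_sub_smul_posSemidef {N : ℕ} [NeZero N] {b : ℕ} (hb : 1 ≤ b)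
    (P : ZMod N → Matrix n n ℂ) (hherm : ∀ i, (P i).IsHermitian) (hidem : ∀ i, P i * P i = P i)
    {ε : ℝ} (hε : 0 < ε)
    (hloc : ∀ i : ZMod N,
      ((∑ j ∈ range b, P (i + (j : ZMod N))) * (∑ j ∈ range b, P (i + (j : ZMod N))) -
        (ε : ℂ) • ∑ j ∈ range b, P (i + (j : ZMod N))).PosSemidef)
    (c : ℕ → ℝ) :
    (∑ i, (∑ j ∈ range b, (c j : ℂ) • P (i + (j : ZMod N))) *
        (∑ j ∈ range b, (c j : ℂ) • P (i + (j : ZMod N))) -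
      (((ε * (∑ j ∈ range b, c j) ^ 2 / b : ℝ)) : ℂ) • ∑ i, P i).PosSemidef := by
  -- notation
  set H : Matrix n n ℂ := ∑ i, P i with hH
  set A : ZMod N → Matrix n n ℂ := fun i => ∑ j ∈ range b, P (i + (j : ZMod N)) with hA
  set B : ZMod N → Matrix n n ℂ := fun i => ∑ j ∈ range b, (c j : ℂ) • P (i + (j : ZMod N)) with hB
  set κ : ℝ := ε * (∑ j ∈ range b, c j) ^ 2 / b with hκ
  -- Hermitian / positivity bookkeeping
  have hPpos : ∀ i, (P i).PosSemidef := fun i => posSemidef_of_isHermitian_of_mul_self (hherm i) (hidem i)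
  have hHpos : H.PosSemidef := posSemidef_sum _ fun i _ => hPpos i
  have hApos : ∀ i, (A i).PosSemidef := fun i => posSemidef_sum _ fun j _ => hPpos _
  have hBherm : ∀ i, (B i).IsHermitian := by
    intro i
    simp only [hB, IsHermitian, conjTranspose_sum, conjTranspose_smul, Complex.star_def,
      Complex.conj_ofReal, (hherm _).eq]
  have hBBpos : ∀ i, (B i * B i).PosSemidef := by
    intro i
    have h := posSemidef_conjTranspose_mul_self (B i)
    rwa [(hBherm i).eq] at h
  have hXpos : (∑ i, B i * B i).PosSemidef := posSemidef_sum _ fun i _ => hBBpos i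
  have hκ0 : 0 ≤ κ := by
    simp only [hκ]; positivity
  -- kernels: `A_i v = 0 ⇒ B_i v = 0`
  have hker : ∀ i (v : n → ℂ), A i *ᵥ v = 0 → B i *ᵥ v = 0 := by
    intro i v hv
    -- `⟨v, A_i v⟩ = Σ_j ‖P_{i+j} v‖² = 0`
    have hsum : ∑ j ∈ range b, star (P (i + (j : ZMod N)) *ᵥ v) ⬝ᵥ (P (i + (j : ZMod N)) *ᵥ v) = 0 := by
      have h0 : star v ⬝ᵥ (A i *ᵥ v) = 0 := by rw [hv, dotProduct_zero]
      rw [hA] at h0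
      simp only [sum_mulVec, dotProduct_sum] at h0
      rw [← h0]
      refine Finset.sum_congr rfl fun j _ => ?_
      rw [← dotProduct_mulVec_mul_self (hherm _), hidem]
    have hzero : ∀ j ∈ range b, P (i + (j : ZMod N)) *ᵥ v = 0 := by
      have hnn : ∀ j ∈ range b,
          0 ≤ star (P (i + (j : ZMod N)) *ᵥ v) ⬝ᵥ (P (i + (j : ZMod N)) *ᵥ v) :=
        fun j _ => dotProduct_star_self_nonneg _
      intro j hj
      have h := (Finset.sum_eq_zero_iff_of_nonneg hnn).1 hsum j hj
      exact dotProduct_star_self_eq_zero.1 h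
    simp only [hB, sum_mulVec, smul_mulVec]
    exact Finset.sum_eq_zero fun j hj => by rw [hzero j hj, smul_zero]
  -- the operator sums `Σ_i A_i = b H`, `Σ_i B_i = (Σ c) H`
  have hsumA : ∑ i, A i = (b : ℂ) • H := by
    simp only [hA, hH]
    rw [sum_comm]
    simp only [sum_shift (fun i => P i)]
    rw [sum_const, card_range, ← Nat.cast_smul_eq_nsmul ℂ]
  have hsumB : ∑ i, B i = (((∑ j ∈ range b, c j : ℝ)) : ℂ) • H := by
    simp only [hB, hH]
    rw [sum_comm]
    simp only [← smul_sum, sum_shift (fun i => P i)]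
    rw [← sum_smul]
    push_cast
    rfl
  -- assemble
  refine PosSemidef.of_dotProduct_mulVec_nonneg (hXpos.1.sub (hHpos.smul (Complex.zero_le_real.2 hκ0)).1)
    fun φ => ?_
  -- real quantities
  set aH : ℝ := (star φ ⬝ᵥ (H *ᵥ φ)).re with haH
  set a : ZMod N → ℝ := fun i => (star φ ⬝ᵥ (A i *ᵥ φ)).re with ha
  set x : ZMod N → ℝ := fun i => (star φ ⬝ᵥ (B i *ᵥ φ)).re with hx
  set y : ZMod N → ℝ := fun i => (star (B i *ᵥ φ) ⬝ᵥ (B i *ᵥ φ)).re with hy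
  have haH0 : 0 ≤ aH := (Complex.nonneg_iff.1 (hHpos.dotProduct_mulVec_nonneg φ)).1
  have ha0 : ∀ i, 0 ≤ a i := fun i => (Complex.nonneg_iff.1 ((hApos i).dotProduct_mulVec_nonneg φ)).1
  have hy0 : ∀ i, 0 ≤ y i := fun i => (Complex.nonneg_iff.1 (dotProduct_star_self_nonneg _)).1
  -- per block: `ε x_i² ≤ a_i y_i`
  have hblock : ∀ i, x i ^ 2 ≤ (a i / ε) * y i := by
    intro i
    have h := eps_mul_normSq_dotProduct_le (hApos i) hε (hloc i) (hBherm i) (hker i) φ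
    have hxle : x i ^ 2 ≤ ‖star φ ⬝ᵥ (B i *ᵥ φ)‖ ^ 2 := by
      rw [hx, sq_le_sq, abs_norm]
      exact Complex.abs_re_le_norm _
    rw [div_mul_eq_mul_div, le_div_iff₀ hε]
    calc x i ^ 2 * ε = ε * x i ^ 2 := by ring
      _ ≤ ε * ‖star φ ⬝ᵥ (B i *ᵥ φ)‖ ^ 2 := mul_le_mul_of_nonneg_left hxle hε.le
      _ ≤ a i * y i := h
  -- Cauchy–Schwarz across the blocks
  have hCS : (∑ i, x i) ^ 2 ≤ (∑ i, a i / ε) * ∑ i, y i :=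
    sum_sq_le_sum_mul_sum_of_sq_le_mul _ (fun i _ => div_nonneg (ha0 i) hε.le) (fun i _ => hy0 i)
      fun i _ => hblock i
  -- the sums: `Σ x_i = (Σ c) aH`, `Σ a_i = b aH`, `Σ y_i = ⟨φ, (Σ B_i²) φ⟩`
  have hsumx : ∑ i, x i = (∑ j ∈ range b, c j) * aH := by
    have h : ∑ i, star φ ⬝ᵥ (B i *ᵥ φ) = (((∑ j ∈ range b, c j : ℝ)) : ℂ) * (star φ ⬝ᵥ (H *ᵥ φ)) := by
      rw [← dotProduct_sum, ← sum_mulVec, hsumB, smul_mulVec, dotProduct_smul, smul_eq_mul]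
    simp only [hx, haH]
    rw [← Complex.re_sum, h, Complex.re_ofReal_mul]
  have hsuma : ∑ i, a i = b * aH := by
    have h : ∑ i, star φ ⬝ᵥ (A i *ᵥ φ) = (b : ℂ) * (star φ ⬝ᵥ (H *ᵥ φ)) := by
      rw [← dotProduct_sum, ← sum_mulVec, hsumA, smul_mulVec, dotProduct_smul, smul_eq_mul]
    simp only [ha, haH]
    rw [← Complex.re_sum, h, show (b : ℂ) = ((b : ℝ) : ℂ) by norm_cast, Complex.re_ofReal_mul]
  have hsumy : star φ ⬝ᵥ ((∑ i, B i * B i) *ᵥ φ) = (((∑ i, y i : ℝ)) : ℂ) := by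
    rw [sum_mulVec, dotProduct_sum]
    push_cast
    refine Finset.sum_congr rfl fun i _ => ?_
    rw [dotProduct_mulVec_eq_re (hBBpos i) φ, dotProduct_mulVec_mul_self (hBherm i)]
  -- the real inequality `κ aH ≤ Σ y`
  have hysum0 : 0 ≤ ∑ i, y i := Finset.sum_nonneg fun i _ => hy0 i
  have hb0 : (0 : ℝ) < b := by exact_mod_cast hb
  have hmain : κ * aH ≤ ∑ i, y i := by
    have hCS' : ((∑ j ∈ range b, c j) * aH) ^ 2 ≤ ((b : ℝ) * aH / ε) * ∑ i, y i := by
      have h := hCS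
      rwa [hsumx, ← Finset.sum_div, hsuma] at h
    rcases haH0.eq_or_lt with h0 | hpos
    · rw [← h0, mul_zero]; exact hysum0
    · have h2 : ((∑ j ∈ range b, c j) * aH) ^ 2 * ε ≤ ((b : ℝ) * aH) * ∑ i, y i := by
        calc ((∑ j ∈ range b, c j) * aH) ^ 2 * ε ≤ (((b : ℝ) * aH / ε) * ∑ i, y i) * ε :=
              mul_le_mul_of_nonneg_right hCS' hε.le
          _ = ((b : ℝ) * aH) * ∑ i, y i := by field_simp
      have h3 : (∑ j ∈ range b, c j) ^ 2 * ε * aH ≤ (b : ℝ) * ∑ i, y i := by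
        have h2' : aH * ((∑ j ∈ range b, c j) ^ 2 * ε * aH) ≤ aH * ((b : ℝ) * ∑ i, y i) := by
          nlinarith [h2]
        exact le_of_mul_le_mul_left h2' hpos
      simp only [hκ]
      rw [div_mul_eq_mul_div, div_le_iff₀ hb0]
      nlinarith [h3]
  rw [sub_mulVec, dotProduct_sub, smul_mulVec, dotProduct_smul, smul_eq_mul, hsumy,
    dotProduct_mulVec_eq_re hHpos φ, ← Complex.ofReal_mul, ← Complex.ofReal_sub, Complex.zero_le_real]
  linarith [hmain]


/-! ### The gap bound for general deformation weights -/

/-- **Gosset–Mozgunov's bound for general weights** `ε° ≥ F(c)(ε_n − G(c))` in operator form.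
[cite: GossetMozgunov2016, §2.2 eqs. (finalbnd), (F), (G)] -/
theorem gossetMozgunov_weighted_ring_sq_sub_smul_posSemidef {N : ℕ} [NeZero N] {b : ℕ} (hb : 2 ≤ b)
    (hN : b + 2 ≤ N) (P : ZMod N → Matrix n n ℂ) (hherm : ∀ i, (P i).IsHermitian)
    (hidem : ∀ i, P i * P i = P i)
    (hcomm : ∀ i d : ZMod N, d ≠ 0 → d ≠ 1 → d ≠ -1 → P i * P (i + d) = P (i + d) * P i)
    {ε : ℝ} (hε : 0 < ε)
    (hloc : ∀ i : ZMod N,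
      ((∑ j ∈ range b, P (i + (j : ZMod N))) * (∑ j ∈ range b, P (i + (j : ZMod N))) -
        (ε : ℂ) • ∑ j ∈ range b, P (i + (j : ZMod N))).PosSemidef)
    (c : ℕ → ℝ) (hq1 : 0 < ∑ r ∈ range (b - 1), c r * c (r + 1))
    (hcond : ∀ t : ℕ, 2 ≤ t → t + 2 ≤ N →
      (∑ r ∈ range (b - t), c r * c (r + t)) + (∑ r ∈ range (b - (N - t)), c r * c (r + (N - t))) ≤
        ∑ r ∈ range (b - 1), c r * c (r + 1)) :
    ((∑ i, P i) * (∑ i, P i) -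
      (((ε * (∑ j ∈ range b, c j) ^ 2 / b -
          ((∑ j ∈ range b, c j * c j) - ∑ r ∈ range (b - 1), c r * c (r + 1))) /
          ∑ r ∈ range (b - 1), c r * c (r + 1) : ℝ) : ℂ) • ∑ i, P i).PosSemidef := by
  set H : Matrix n n ℂ := ∑ i, P i with hH
  set q1 : ℝ := ∑ r ∈ range (b - 1), c r * c (r + 1) with hq1def
  set s2 : ℝ := ∑ j ∈ range b, c j * c j with hs2
  set κ : ℝ := ε * (∑ j ∈ range b, c j) ^ 2 / b with hκ
  set X : Matrix n n ℂ := ∑ i, (∑ j ∈ range b, (c j : ℂ) • P (i + (j : ZMod N))) *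
    (∑ j ∈ range b, (c j : ℂ) • P (i + (j : ZMod N))) with hX
  have h2 := gossetMozgunov_weighted_sq_posSemidef hb hN P hherm hidem hcomm c hcond
  have h4 := gossetMozgunov_sum_weighted_sq_sub_smul_posSemidef (by omega : 1 ≤ b) P hherm hidem hε
    hloc c
  have hsum := h2.add h4
  -- `q1 H² + (s2 - q1) H - X + (X - κ H) = q1 H² - (κ - s2 + q1) H`
  have hid : H * H - (((κ - (s2 - q1)) / q1 : ℝ) : ℂ) • H =
      ((q1⁻¹ : ℝ) : ℂ) • ((((q1 : ℝ)) : ℂ) • (H * H) + (((s2 - q1 : ℝ)) : ℂ) • H - X +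
        (X - ((κ : ℝ) : ℂ) • H)) := by
    have hq1c : ((q1⁻¹ : ℝ) : ℂ) * ((q1 : ℝ) : ℂ) = 1 := by
      rw [← Complex.ofReal_mul, inv_mul_cancel₀ hq1.ne', Complex.ofReal_one]
    have e1 : ((q1⁻¹ : ℝ) : ℂ) • (((q1 : ℝ) : ℂ) • (H * H)) = H * H := by
      rw [smul_smul, hq1c, one_smul]
    rw [div_eq_inv_mul, Complex.ofReal_mul, Complex.ofReal_sub, Complex.ofReal_sub]
    simp only [smul_add, smul_sub]
    rw [e1]
    module
  rw [hid]
  exact hsum.smul (Complex.zero_le_real.2 (inv_nonneg.2 hq1.le))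

/-! ### Gosset–Mozgunov's quadratic weights `c_j = (j+1)(n-1-j)` and the threshold `6/(n(n+1))` -/

/-- Partial sums of the autocorrelation of the quadratic weights `c_r = (r+1)(b-r)` (closed form, degree 5).
[cite: GossetMozgunov2016, §2.2 eqs. (csum)–(ccp1)] -/
theorem gossetMozgunov_weights_partial_sum (b t : ℝ) (M : ℕ) :
    30 * ∑ r ∈ range M, (((r : ℝ) + 1) * (b - r)) * (((r : ℝ) + t + 1) * (b - (r + t))) =
      6 * (M : ℝ) ^ 5 + 15 * (M : ℝ) ^ 4 * t - 15 * (M : ℝ) ^ 4 * b - 10 * (M : ℝ) ^ 3 +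
        10 * (M : ℝ) ^ 3 * t ^ 2 - 10 * (M : ℝ) ^ 3 * b - 30 * (M : ℝ) ^ 3 * b * t +
        10 * (M : ℝ) ^ 3 * b ^ 2 - 15 * (M : ℝ) ^ 2 * t + 15 * (M : ℝ) ^ 2 * b -
        15 * (M : ℝ) ^ 2 * b * t - 15 * (M : ℝ) ^ 2 * b * t ^ 2 + 15 * (M : ℝ) ^ 2 * b ^ 2 +
        15 * (M : ℝ) ^ 2 * b ^ 2 * t + 4 * (M : ℝ) - 10 * (M : ℝ) * t ^ 2 + 10 * (M : ℝ) * b +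
        15 * (M : ℝ) * b * t - 15 * (M : ℝ) * b * t ^ 2 + 5 * (M : ℝ) * b ^ 2 +
        15 * (M : ℝ) * b ^ 2 * t := by
  induction M with
  | zero => simp
  | succ M ih =>
    rw [sum_range_succ, mul_add, ih]
    push_cast
    ring

/-- `Σ_{r<M} (r+1)(b-r)` in closed form. [cite: GossetMozgunov2016, §2.2 eq. (csum)] -/
theorem gossetMozgunov_weights_sum (b : ℝ) (M : ℕ) :
    6 * ∑ r ∈ range M, ((r : ℝ) + 1) * (b - r) =
      2 * (M : ℝ) + 3 * (M : ℝ) * b + 3 * (M : ℝ) ^ 2 * b - 2 * (M : ℝ) ^ 3 := by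
  induction M with
  | zero => simp
  | succ M ih =>
    rw [sum_range_succ, mul_add, ih]
    push_cast
    ring

/-- ★★ **Gosset–Mozgunov's Theorem 3 (local gap threshold `6/(n(n+1))`), operator form.**
[cite: GossetMozgunov2016, Thm. 3] -/
theorem gossetMozgunov_ring_sq_sub_smul_posSemidef {N : ℕ} [NeZero N] {b : ℕ} (hb : 2 ≤ b)
    (hN : b + 2 ≤ N) (hN2 : 2 * b ≤ N + 1) (P : ZMod N → Matrix n n ℂ)
    (hherm : ∀ i, (P i).IsHermitian) (hidem : ∀ i, P i * P i = P i)
    (hcomm : ∀ i d : ZMod N, d ≠ 0 → d ≠ 1 → d ≠ -1 → P i * P (i + d) = P (i + d) * P i)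
    {ε : ℝ} (hε : 0 < ε)
    (hloc : ∀ i : ZMod N,
      ((∑ j ∈ range b, P (i + (j : ZMod N))) * (∑ j ∈ range b, P (i + (j : ZMod N))) -
        (ε : ℂ) • ∑ j ∈ range b, P (i + (j : ZMod N))).PosSemidef) :
    ((∑ i, P i) * (∑ i, P i) -
      ((5 * ((b : ℝ) + 1) * ((b : ℝ) + 2) / (6 * ((b : ℝ) - 1) * ((b : ℝ) + 3)) *
          (ε - 6 / (((b : ℝ) + 1) * ((b : ℝ) + 2))) : ℝ) : ℂ) • ∑ i, P i).PosSemidef := by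
  -- the weights and their autocorrelation
  set c : ℕ → ℝ := fun j => ((j : ℝ) + 1) * ((b : ℝ) - j) with hc
  set q : ℕ → ℝ := fun t => ∑ r ∈ range (b - t), c r * c (r + t) with hq
  have hqP : ∀ t : ℕ, t ≤ b → 30 * q t =
      6 * ((b - t : ℕ) : ℝ) ^ 5 + 15 * ((b - t : ℕ) : ℝ) ^ 4 * t - 15 * ((b - t : ℕ) : ℝ) ^ 4 * b -
        10 * ((b - t : ℕ) : ℝ) ^ 3 +
        10 * ((b - t : ℕ) : ℝ) ^ 3 * (t : ℝ) ^ 2 - 10 * ((b - t : ℕ) : ℝ) ^ 3 * b -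
        30 * ((b - t : ℕ) : ℝ) ^ 3 * b * t +
        10 * ((b - t : ℕ) : ℝ) ^ 3 * (b : ℝ) ^ 2 - 15 * ((b - t : ℕ) : ℝ) ^ 2 * t +
        15 * ((b - t : ℕ) : ℝ) ^ 2 * b -
        15 * ((b - t : ℕ) : ℝ) ^ 2 * b * t - 15 * ((b - t : ℕ) : ℝ) ^ 2 * b * (t : ℝ) ^ 2 +
        15 * ((b - t : ℕ) : ℝ) ^ 2 * (b : ℝ) ^ 2 +
        15 * ((b - t : ℕ) : ℝ) ^ 2 * (b : ℝ) ^ 2 * t + 4 * ((b - t : ℕ) : ℝ) -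
        10 * ((b - t : ℕ) : ℝ) * (t : ℝ) ^ 2 + 10 * ((b - t : ℕ) : ℝ) * b +
        15 * ((b - t : ℕ) : ℝ) * b * t - 15 * ((b - t : ℕ) : ℝ) * b * (t : ℝ) ^ 2 +
        5 * ((b - t : ℕ) : ℝ) * (b : ℝ) ^ 2 +
        15 * ((b - t : ℕ) : ℝ) * (b : ℝ) ^ 2 * t := by
    intro t _
    rw [← gossetMozgunov_weights_partial_sum (b : ℝ) (t : ℝ) (b - t)]
    congr 1
    refine sum_congr rfl fun r _ => ?_
    simp only [hc]
    push_cast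
    ring
  have hq1 : q 1 = (b : ℝ) * ((b : ℝ) - 1) * ((b : ℝ) + 1) * ((b : ℝ) + 2) * ((b : ℝ) + 3) / 30 := by
    have h := hqP 1 (by omega)
    rw [Nat.cast_sub (by omega : 1 ≤ b)] at h
    push_cast at h
    linear_combination h / 30
  have hq0 : q 0 = ((b : ℝ) ^ 5 + 5 * (b : ℝ) ^ 4 + 10 * (b : ℝ) ^ 3 + 10 * (b : ℝ) ^ 2 + 4 * b) / 30 := by
    have h := hqP 0 (by omega)
    rw [Nat.sub_zero] at h
    push_cast at h
    linear_combination h / 30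
  have hs2 : ∑ j ∈ range b, c j * c j = q 0 := by
    simp only [hq, Nat.sub_zero, add_zero]
  have hs1 : ∑ j ∈ range b, c j = (b : ℝ) * ((b : ℝ) + 1) * ((b : ℝ) + 2) / 6 := by
    have h := gossetMozgunov_weights_sum (b : ℝ) b
    simp only [hc]
    linear_combination h / 6
  have hb2 : (2 : ℝ) ≤ b := by exact_mod_cast hb
  have hq1pos : 0 < q 1 := by
    rw [hq1]
    have : 0 < (b : ℝ) - 1 := by linarith
    positivity
  -- the monotonicity certificate: `q(t) ≤ q(1)` for `2 ≤ t ≤ b - 1`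
  have hqle : ∀ t : ℕ, 2 ≤ t → t + 1 ≤ b → q t ≤ q 1 := by
    intro t ht htb
    obtain ⟨s, rfl⟩ : ∃ s, t = s + 2 := ⟨t - 2, by omega⟩
    obtain ⟨k, hk⟩ : ∃ k, b = s + k + 3 := ⟨b - s - 3, by omega⟩
    have ht := hqP (s + 2) (by omega)
    have h1 := hqP 1 (by omega)
    rw [show b - (s + 2) = k + 1 by omega] at ht
    rw [show b - 1 = s + k + 2 by omega] at h1
    rw [hk] at ht h1
    push_cast at ht h1
    have hD : 30 * (q 1 - q (s + 2)) =
        450 + 465 * (k : ℝ) + 150 * (k : ℝ) ^ 2 + 15 * (k : ℝ) ^ 3 + 864 * (s : ℝ) +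
          800 * (s : ℝ) * k + 230 * (s : ℝ) * (k : ℝ) ^ 2 + 20 * (s : ℝ) * (k : ℝ) ^ 3 +
          550 * (s : ℝ) ^ 2 + 410 * (s : ℝ) ^ 2 * k + 90 * (s : ℝ) ^ 2 * (k : ℝ) ^ 2 +
          5 * (s : ℝ) ^ 2 * (k : ℝ) ^ 3 + 155 * (s : ℝ) ^ 3 + 80 * (s : ℝ) ^ 3 * k +
          10 * (s : ℝ) ^ 3 * (k : ℝ) ^ 2 + 20 * (s : ℝ) ^ 4 + 5 * (s : ℝ) ^ 4 * k + (s : ℝ) ^ 5 := by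
      linear_combination h1 - ht
    have hDpos : 0 ≤ 30 * (q 1 - q (s + 2)) := by
      rw [hD]; positivity
    linarith
  have hqvan : ∀ t : ℕ, b ≤ t → q t = 0 := by
    intro t ht
    simp only [hq, Nat.sub_eq_zero_of_le ht, range_zero, sum_empty]
  have hcond : ∀ t : ℕ, 2 ≤ t → t + 2 ≤ N →
      (∑ r ∈ range (b - t), c r * c (r + t)) + (∑ r ∈ range (b - (N - t)), c r * c (r + (N - t))) ≤
        ∑ r ∈ range (b - 1), c r * c (r + 1) := by
    intro t ht htN
    change q t + q (N - t) ≤ q 1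
    by_cases h1 : t + 1 ≤ b
    · rw [hqvan (N - t) (by omega), add_zero]
      exact hqle t ht h1
    · rw [hqvan t (by omega), zero_add]
      by_cases h2 : N - t + 1 ≤ b
      · exact hqle (N - t) (by omega) h2
      · rw [hqvan (N - t) (by omega)]
        exact hq1pos.le
  -- the general-weights bound
  have hmain := gossetMozgunov_weighted_ring_sq_sub_smul_posSemidef hb hN P hherm hidem hcomm hε hloc c
    hq1pos hcond
  -- the constants
  have hcoef : (ε * (∑ j ∈ range b, c j) ^ 2 / b -
      ((∑ j ∈ range b, c j * c j) - ∑ r ∈ range (b - 1), c r * c (r + 1))) /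
      (∑ r ∈ range (b - 1), c r * c (r + 1)) =
      5 * ((b : ℝ) + 1) * ((b : ℝ) + 2) / (6 * ((b : ℝ) - 1) * ((b : ℝ) + 3)) *
        (ε - 6 / (((b : ℝ) + 1) * ((b : ℝ) + 2))) := by
    change (ε * (∑ j ∈ range b, c j) ^ 2 / b - ((∑ j ∈ range b, c j * c j) - q 1)) / q 1 = _
    rw [hs1, hs2, hq0, hq1]
    have h0 : (b : ℝ) ≠ 0 := by positivity
    have h1 : (b : ℝ) - 1 ≠ 0 := by linarith
    have h3 : (b : ℝ) + 3 ≠ 0 := by positivity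
    have h4 : (b : ℝ) + 1 ≠ 0 := by positivity
    have h5 : (b : ℝ) + 2 ≠ 0 := by positivity
    field_simp
    ring
  rw [← hcoef]
  exact hmain

/-- **Theorem 3, parametrised by the number `n ≥ 3` of sites of a block** (`n - 1` bond projections per block; ring
of `N ≥ max(n + 1, 2n - 3)` bonds, implied by the printed `m > 2n`):
`H² - (5/6)((n²+n)/(n²-4)) (ε - 6/(n(n+1))) H ≥ 0`. [cite: GossetMozgunov2016, Thm. 3] -/
theorem gossetMozgunov_ring_sq_sub_smul_posSemidef_sites {N : ℕ} [NeZero N] {ns : ℕ} (hns : 3 ≤ ns)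
    (hN : ns + 1 ≤ N) (hN2 : 2 * ns ≤ N + 3) (P : ZMod N → Matrix n n ℂ)
    (hherm : ∀ i, (P i).IsHermitian) (hidem : ∀ i, P i * P i = P i)
    (hcomm : ∀ i d : ZMod N, d ≠ 0 → d ≠ 1 → d ≠ -1 → P i * P (i + d) = P (i + d) * P i)
    {ε : ℝ} (hε : 0 < ε)
    (hloc : ∀ i : ZMod N,
      ((∑ j ∈ range (ns - 1), P (i + (j : ZMod N))) * (∑ j ∈ range (ns - 1), P (i + (j : ZMod N))) -
        (ε : ℂ) • ∑ j ∈ range (ns - 1), P (i + (j : ZMod N))).PosSemidef) :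
    ((∑ i, P i) * (∑ i, P i) -
      ((5 / 6 * (((ns : ℝ) ^ 2 + ns) / ((ns : ℝ) ^ 2 - 4)) *
          (ε - 6 / ((ns : ℝ) * ((ns : ℝ) + 1))) : ℝ) : ℂ) • ∑ i, P i).PosSemidef := by
  have h := gossetMozgunov_ring_sq_sub_smul_posSemidef (b := ns - 1) (by omega) (by omega) (by omega) P
    hherm hidem hcomm hε hloc
  have hcoef : 5 * (((ns - 1 : ℕ) : ℝ) + 1) * (((ns - 1 : ℕ) : ℝ) + 2) /
      (6 * (((ns - 1 : ℕ) : ℝ) - 1) * (((ns - 1 : ℕ) : ℝ) + 3)) *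
      (ε - 6 / ((((ns - 1 : ℕ) : ℝ) + 1) * (((ns - 1 : ℕ) : ℝ) + 2))) =
      5 / 6 * (((ns : ℝ) ^ 2 + ns) / ((ns : ℝ) ^ 2 - 4)) * (ε - 6 / ((ns : ℝ) * ((ns : ℝ) + 1))) := by
    have h1 : ((ns - 1 : ℕ) : ℝ) = (ns : ℝ) - 1 := by
      rw [Nat.cast_sub (by omega), Nat.cast_one]
    have h3 : (3 : ℝ) ≤ ns := by exact_mod_cast hns
    have h2 : (ns : ℝ) - 2 ≠ 0 := by linarith
    have h4 : (ns : ℝ) + 2 ≠ 0 := by linarith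
    have h5 : (ns : ℝ) ≠ 0 := by linarith
    have h6 : (ns : ℝ) + 1 ≠ 0 := by linarith
    have h7 : (ns : ℝ) ^ 2 - 4 = ((ns : ℝ) - 2) * ((ns : ℝ) + 2) := by ring
    rw [h1, h7, show (ns : ℝ) - 1 + 1 = ns by ring, show (ns : ℝ) - 1 + 2 = ns + 1 by ring,
      show (ns : ℝ) - 1 - 1 = ns - 2 by ring, show (ns : ℝ) - 1 + 3 = ns + 2 by ring]
    field_simp
  rw [← hcoef]
  exact h

/-- ★★ **Gosset–Mozgunov's Theorem 3 in its printed form** ("`ε°_m ≥ (5/6)((n²+n)/(n²-4))(ε_n - 6/(n(n+1)))`"):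
under the hypotheses of `gossetMozgunov_ring_sq_sub_smul_posSemidef`, every NON-ZERO eigenvalue `μ` of
`H = Σ_i P_i` satisfies `μ ≥ (5(b+1)(b+2)/(6(b-1)(b+3))) (ε - 6/((b+1)(b+2)))` (`b = n - 1`).
[cite: GossetMozgunov2016, Thm. 3] -/
theorem gossetMozgunov_ring_eigenvalue_eq_zero_or_le {N : ℕ} [NeZero N] {b : ℕ} (hb : 2 ≤ b)
    (hN : b + 2 ≤ N) (hN2 : 2 * b ≤ N + 1) (P : ZMod N → Matrix n n ℂ)
    (hherm : ∀ i, (P i).IsHermitian) (hidem : ∀ i, P i * P i = P i)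
    (hcomm : ∀ i d : ZMod N, d ≠ 0 → d ≠ 1 → d ≠ -1 → P i * P (i + d) = P (i + d) * P i)
    {ε : ℝ} (hε : 0 < ε)
    (hloc : ∀ i : ZMod N,
      ((∑ j ∈ range b, P (i + (j : ZMod N))) * (∑ j ∈ range b, P (i + (j : ZMod N))) -
        (ε : ℂ) • ∑ j ∈ range b, P (i + (j : ZMod N))).PosSemidef)
    {μ : ℝ} {v : n → ℂ} (hv : (∑ i, P i) *ᵥ v = (μ : ℂ) • v) (hv0 : v ≠ 0) :
    μ = 0 ∨ 5 * ((b : ℝ) + 1) * ((b : ℝ) + 2) / (6 * ((b : ℝ) - 1) * ((b : ℝ) + 3)) *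
      (ε - 6 / (((b : ℝ) + 1) * ((b : ℝ) + 2))) ≤ μ := by
  have hH : (∑ i, P i).PosSemidef :=
    posSemidef_sum _ fun i _ => posSemidef_of_isHermitian_of_mul_self (hherm i) (hidem i)
  exact eigenvalue_eq_zero_or_le_of_sq_sub_smul_posSemidef hH
    (gossetMozgunov_ring_sq_sub_smul_posSemidef hb hN hN2 P hherm hidem hcomm hε hloc) hv hv0

end GossetMozgunov

end Literature.MathematicalPhysics.QuantumLattice

end
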